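import Summits.Ventures.PercRepro.RankLevelSetAbsorbStarFourEleven
import Summits.Ventures.PercRepro.RankLevelSetStarPlusThreeSplit

/-! # RankLevelSetAbsorbStarFourColoops — THE STEP `k = 4` OF (ABS-star) ACROSS THE COLOOPS: EVERY MATROID WHOSE
COLOOP-FREE PART HAS AT LEAST `11` ELEMENTS (night-1 g36; dossier §48.11; on `RankLevelSetAbsorbStarFourEleven`
and `RankLevelSetStarPlusThreeSplit`)

Across a coloop `x ≠ y` the absorbing profile splits as `A^y_{j+1}(M) = A^y_j(M ＼ {x}) + A^y_{j+1}(M ＼ {x})`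
(`lowAbsorbCount_succ_of_coloop`), so the step `k` of `M` follows from the steps `k − 1` and `k` of `M ＼ {x}`
(**`absorbStar_step_of_coloop`**: `(n − 1 − k)(A'_{k−1} + A'_k) ≤ (k − 1)A'_k + A'_k + kA'_{k+1}`). Deleting a coloop
removes it from the coloops and nothing else (`contract_eq_delete_of_subset_coloops`, `contract_coloops_eq`), so an
induction on the number of coloops with `absorbStar_step_three_all` (the step `3` for every element) and
`absorbStar_step_four_all_of_coloopFree` (the step `4` on coloop-free matroids with `≥ 11` elements) gives
**`absorbStar_step_four_all : 11 ≤ #E − #coloops → (#E − 5) · A^y_4 ≤ 4 · A^y_5`** for every element `y` of every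
finite matroid. Every declaration has a docstring; imports: the cell's own modules and Mathlib only. Axioms:
standard. -/

namespace PercRepro

open Set Matroid

variable {α : Type} [DecidableEq α] (M : Matroid α) [M.Finite]

/-! ## The step across a coloop -/

omit [DecidableEq α] in
/-- **The step `k` of (ABS-star) across a coloop `x ≠ y`** follows from the steps `k − 1` and `k` of `M ＼ {x}`
(`1 ≤ k`, `k + 2 ≤ #E`). -/
lemma absorbStar_step_of_coloop {x y : α} (hx : M.IsColoop x) (hyx : y ≠ x) {k : ℕ} (hk : 1 ≤ k)
    (hkn : k + 2 ≤ M.E.ncard)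
    (h1 : ((M.delete {x}).E.ncard - 1 - (k - 1)) * lowAbsorbCount (M.delete {x}) y (k - 1) ≤
      (k - 1) * lowAbsorbCount (M.delete {x}) y k)
    (h2 : ((M.delete {x}).E.ncard - 1 - k) * lowAbsorbCount (M.delete {x}) y k ≤
      k * lowAbsorbCount (M.delete {x}) y (k + 1)) :
    (M.E.ncard - 1 - k) * lowAbsorbCount M y k ≤ k * lowAbsorbCount M y (k + 1) := by
  obtain ⟨j, rfl⟩ : ∃ j, k = j + 1 := ⟨k - 1, by omega⟩
  simp only [Nat.add_sub_cancel] at h1 ⊢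
  have hcard : (M.delete {x}).E.ncard = M.E.ncard - 1 := by
    rw [Matroid.delete_ground, Set.ncard_sdiff_singleton_of_mem hx.mem_ground]
  have hAk : lowAbsorbCount M y (j + 1) =
      lowAbsorbCount (M.delete {x}) y j + lowAbsorbCount (M.delete {x}) y (j + 1) :=
    lowAbsorbCount_succ_of_coloop M hx hyx j
  have hAk1 := lowAbsorbCount_succ_of_coloop M hx hyx (j + 1)
  rw [hcard] at h1 h2
  rw [hAk, hAk1]
  generalize hA : lowAbsorbCount (M.delete {x}) y j = A at h1 ⊢
  generalize hB : lowAbsorbCount (M.delete {x}) y (j + 1) = B at h1 h2 ⊢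
  generalize hC : lowAbsorbCount (M.delete {x}) y (j + 1 + 1) = C at h2 ⊢
  generalize hm : M.E.ncard - 1 - 1 - (j + 1) = m at h2 ⊢
  have e1 : M.E.ncard - 1 - (j + 1) = m + 1 := by omega
  have e2 : M.E.ncard - 1 - 1 - j = m + 1 := by omega
  rw [e1]
  rw [e2] at h1
  calc (m + 1) * (A + B) = (m + 1) * A + (m * B + B) := by ring
    _ ≤ j * B + ((j + 1) * C + B) := Nat.add_le_add h1 (Nat.add_le_add_right h2 B)
    _ = (j + 1) * (B + C) := by ring

/-! ## Induction on the number of coloops -/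

omit [DecidableEq α] [M.Finite] in
/-- Deleting a coloop removes exactly it from the coloops. -/
lemma coloops_delete_of_isColoop {x : α} (hx : M.IsColoop x) : (M.delete {x}).coloops = M.coloops \ {x} := by
  rw [← Matroid.contract_eq_delete_of_subset_coloops (Set.singleton_subset_iff.mpr hx),
    Matroid.contract_coloops_eq]

/-- The auxiliary induction on the number of coloops. -/
theorem absorbStar_step_four_all_aux : ∀ c : ℕ, ∀ (M' : Matroid α) [M'.Finite], M'.coloops.ncard = c →
    11 ≤ M'.E.ncard - c → ∀ y ∈ M'.E, (M'.E.ncard - 5) * lowAbsorbCount M' y 4 ≤ 4 * lowAbsorbCount M' y 5 := by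
  intro c
  induction c with
  | zero =>
    intro M' _ hc hn y hy
    have hcol : ∀ e, ¬ M'.IsColoop e := by
      intro e he
      have hfin : M'.coloops.Finite := M'.ground_finite.subset M'.coloops_subset_ground
      rw [Set.ncard_eq_zero hfin] at hc
      exact (Set.eq_empty_iff_forall_notMem.mp hc e) he
    exact absorbStar_step_four_all_of_coloopFree M' hcol hy (by omega)
  | succ c ih =>
    intro M' _ hc hn y hy
    have hfin : M'.coloops.Finite := M'.ground_finite.subset M'.coloops_subset_ground
    obtain ⟨x, hx⟩ : M'.coloops.Nonempty := by rw [← Set.ncard_pos hfin, hc]; omega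
    have hxc : M'.IsColoop x := hx
    by_cases hyx : y = x
    · rw [hyx, lowAbsorbCount_eq_zero_of_isColoop M' hxc 4, Nat.mul_zero]
      exact Nat.zero_le _
    haveI := delete_finite' M' x
    have hcard : (M'.delete {x}).E.ncard = M'.E.ncard - 1 := by
      rw [Matroid.delete_ground, Set.ncard_sdiff_singleton_of_mem hxc.mem_ground]
    have hc' : (M'.delete {x}).coloops.ncard = c := by
      rw [coloops_delete_of_isColoop M' hxc, Set.ncard_sdiff_singleton_of_mem hx, hc]
      rfl
    have hyM : y ∈ (M'.delete {x}).E := by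
      rw [Matroid.delete_ground]; exact ⟨hy, by simpa using hyx⟩
    have hn' : 11 ≤ (M'.delete {x}).E.ncard - c := by rw [hcard]; omega
    have h3 : ((M'.delete {x}).E.ncard - 1 - (4 - 1)) * lowAbsorbCount (M'.delete {x}) y (4 - 1) ≤
        (4 - 1) * lowAbsorbCount (M'.delete {x}) y 4 := by
      have := absorbStar_step_three_all (M'.delete {x}) hyM (by rw [hcard]; omega)
      rw [show (M'.delete {x}).E.ncard - 1 - (4 - 1) = (M'.delete {x}).E.ncard - 4 by omega]
      exact this
    have h4 : ((M'.delete {x}).E.ncard - 1 - 4) * lowAbsorbCount (M'.delete {x}) y 4 ≤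
        4 * lowAbsorbCount (M'.delete {x}) y (4 + 1) := by
      have := ih (M'.delete {x}) hc' hn' y hyM
      rw [show (M'.delete {x}).E.ncard - 1 - 4 = (M'.delete {x}).E.ncard - 5 by omega]
      exact this
    have := absorbStar_step_of_coloop M' hxc hyx (k := 4) (by norm_num) (by omega) h3 h4
    rw [show M'.E.ncard - 1 - 4 = M'.E.ncard - 5 by omega] at this
    exact this

/-- **THE STEP `k = 4` OF (ABS-star) FOR EVERY ELEMENT OF EVERY FINITE MATROID WHOSE COLOOP-FREE PART HAS AT LEAST
`11` ELEMENTS**: `11 ≤ #E − #coloops → (#E − 5) · A^y_4 ≤ 4 · A^y_5`. -/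
theorem absorbStar_step_four_all (hn : 11 ≤ M.E.ncard - M.coloops.ncard) {y : α} (hy : y ∈ M.E) :
    (M.E.ncard - 5) * lowAbsorbCount M y 4 ≤ 4 * lowAbsorbCount M y 5 :=
  absorbStar_step_four_all_aux M.coloops.ncard M rfl hn y hy

end PercRepro
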